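import Literature.MathematicalPhysics.QuantumFieldTheory.Balaban1983to89.HaarExpChartChangeOfVariablesPi

/-!
# `Balaban1983to89.HaarExpChartChangeOfVariablesPiMeasure` — the MEASURE FORM and the BOCHNER FORM of the group-level
# Jacobian on `G^B` (file 2 `HaarExpChartChangeOfVariablesPi` §4): `(⊗μ)|_{Ψ(Θ^B S)} = Ψ_*(J_Ψ · (⊗μ)|_{Θ^B S})` and
# `∫_{Ψ(Θ^B S)} F d⊗μ = ∫_{Θ^B S} J_Ψ(U) • F(Ψ U) d⊗μ` for Banach-valued `F`, with the a.e.-measurability of `Ψ` and `J_Ψ`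
# transported through the product chart — the «fibred chart» shape `ν|_{…} = Φ_*(J · …)` on the product Haar measure of
# the bond variables ([Balaban1985UV3] (18) p. 260, [Balaban1987RG1] (2.10) p. 267 read without δ-functions)

statement-level skeleton of published theorems with citation tags; proofs where landed; nothing here is a claim
about the Yang–Mills mass gap

Cell `pub-ymgap`, seat `pub-ymgap-dag-n09-w4` (gen 4; node N09, helper lane of the K1⁷ item, count-neutral).  File 3 of the
(F1) group-chart composition (file 1 `HaarExpChartChangeOfVariables` = one variable, all forms; file 2 = `G^B`, `lintegral`
forms).  SETTING = file 2's; `Θ^B A = (Θ A_b)_b`, `Λ^B U = (Λ U_b)_b`,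
`J_Ψ(U) = (Π_b |det jac((ψ(Λ^B U))_b)|) · |det ψ′(Λ^B U)| / Π_b |det jac(Λ U_b)|`.

CONTENT (theorems only; 0 def, 0 instance, 0 sorry; axioms standard).
* §1 a.e.-MEASURABILITY THROUGH THE PRODUCT CHART: `aemeasurable_pi_restrict_image_of_comp_piChart` (a function on `G^B`
  whose chart reading is `(⊗η)|_T`-a.e.-measurable is `(⊗μ)|_{Θ^B T}`-a.e.-measurable), `aemeasurable_pi_restrict_image_of_semiconj`
  (`Ψ` reading a `ψ` continuous on `S`), `aemeasurable_pi_jacobian` (`J_Ψ`, via Mathlib `aemeasurable_fderivWithin` on `B → 𝔤`),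
  `pi_jacobian_lt_top_ae`.
* §2 **`pi_haar_restrict_image_eq_map_withDensity_jacobian`** (the measure form) and
  **`setIntegral_pi_haar_image_eq_integral_jacobian_smul`** (the Bochner form, `F : (B → G) → E`).
* §3 `pi_haar_restrict_image_prod_eq_smul_map` — file 2's window identity tensored with any s-finite `τ`: the coarse side
  `(⊗μ)|_{Θ^B T} ⊗ τ` of a fibred chart read in bond-wise exponential coordinates.
* §4 TRANSLATED WINDOWS (`μ` right invariant, any centre `U₀ ∈ G^B`): `pi_haar_restrict_translate_image_eq_smul`,
  `lintegral_pi_haar_translate_image_eq`, `pi_haar_restrict_translate_image_prod_eq_smul_map`.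

HONEST SCOPE.  Standard measure theory; nothing of Bałaban's asserted or estimated; no chart of Bałaban's constructed (`ψ`,
`ψ′`, `S`, `Ψ` are the consumer's); `σ₀` never appears (Haar to Haar); nothing of p28 ∕ files 1–2 ∕ Mathlib re-proved;
windows `S ⊆ B(0,s)^B`, `ψ(S) ⊆ B(0,s)^B`, `s ≤ s_C` only.
-/

noncomputable section

open NormedSpace Set Function Filter Topology MeasureTheory
open scoped ENNReal NNReal

namespace Literature.MathematicalPhysics.QuantumFieldTheory.Balaban1983to89.HaarExponentialChart

namespace IsChartRep

open B13HaarSigmaJacobian (jac)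

variable {𝔸 : Type*} [NormedRing 𝔸] [NormedAlgebra ℂ 𝔸] [CompleteSpace 𝔸]
variable {G : Type*} [Group G] [TopologicalSpace G] [IsTopologicalGroup G] [CompactSpace G]
variable {C : LogChart 𝔸} {ρ : G →* 𝔸} (h : IsChartRep C ρ) [FiniteDimensional ℝ C.lie]
  (hlie : ∀ x ∈ C.lie, ∀ y ∈ C.lie, x * y - y * x ∈ C.lie)
variable [MeasurableSpace C.lie] [BorelSpace C.lie] (η : Measure C.lie) [η.IsAddHaarMeasure]
variable [MeasurableSpace G] [BorelSpace G] (μ : Measure G) [μ.IsHaarMeasure]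
variable (B : Type*) [Fintype B]

/-! ## §1 a.e.-measurability transported through the product chart -/

include hlie in
/-- **TRANSPORT OF a.e.-MEASURABILITY THROUGH THE PRODUCT CHART**: a function on `G^B` whose chart reading `g ∘ Θ^B` is
`(⊗η)|_T`-a.e.-measurable is `(⊗μ)|_{Θ^B T}`-a.e.-measurable, for every Borel injectivity domain `Ω` of `Θ` (`0 < s ≤ s_C`) and
every Borel `T ⊆ Ω^B` — through `(⊗μ)|_{Θ^B T} = σ₀^{|B|} • (Θ^B)_*((Π|det jac|) · (⊗η)|_T)`, the measurable embedding `T.restrict Θ^B`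
and `(Π|det jac|) · ⊗η ≪ ⊗η`. [cite: Balaban1985UV3, (18) p. 260] [cite: Helgason2000, Ch. I §1 Thm. 1.14 (13) p. 96] -/
theorem aemeasurable_pi_restrict_image_of_comp_piChart {s : ℝ} (hs0 : 0 < s) (hs : s ≤ chartRadius C)
    {Ω : Set C.lie} (hΩ : MeasurableSet Ω) (hinj : Set.InjOn h.expChart Ω) {T : Set (B → C.lie)} (hT : MeasurableSet T)
    (hTΩ : T ⊆ Set.pi Set.univ fun _ => Ω) {β : Type*} [MeasurableSpace β] {g : (B → G) → β}
    (hg : AEMeasurable (g ∘ fun (A : B → C.lie) (b : B) => h.expChart (A b)) ((Measure.pi fun _ : B => η).restrict T)) :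
    AEMeasurable g ((Measure.pi fun _ : B => μ).restrict ((fun (A : B → C.lie) (b : B) => h.expChart (A b)) '' T)) := by
  haveI : T2Space G := h.isClosedEmbedding.isEmbedding.t2Space
  haveI : SecondCountableTopology G := h.secondCountableTopology
  have hΘB : Measurable (fun (A : B → C.lie) (b : B) => h.expChart (A b)) :=
    measurable_pi_lambda _ fun b => h.measurable_expChart.comp (measurable_pi_apply b)
  have hemb : MeasurableEmbedding (T.restrict fun (A : B → C.lie) (b : B) => h.expChart (A b)) :=
    (continuous_pi fun b => h.continuous_expChart.comp (continuous_apply b)).continuousOn.measurableEmbedding hT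
      ((h.injOn_piChart_pi B hinj).mono hTΩ)
  have hc := h.windowConst_ne_zero_and_ne_top hlie η μ hs0 hs
  rw [h.pi_haar_restrict_image_eq_smul hlie η μ B hs0 hs hΩ hinj hT hTΩ, ← restrict_withDensity hT, ← map_comap_subtype_coe hT,
    Measure.map_map hΘB measurable_subtype_coe]
  refine AEMeasurable.smul_measure ?_ _
  have hcomp0 : (fun (A : B → C.lie) (b : B) => h.expChart (A b)) ∘ ((↑) : T → (B → C.lie)) =
      T.restrict (fun (A : B → C.lie) (b : B) => h.expChart (A b)) := rfl
  rw [hcomp0, hemb.aemeasurable_map_iff]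
  have hcomp : g ∘ T.restrict (fun (A : B → C.lie) (b : B) => h.expChart (A b)) =
      (g ∘ fun (A : B → C.lie) (b : B) => h.expChart (A b)) ∘ ((↑) : T → (B → C.lie)) := rfl
  rw [hcomp, ← (MeasurableEmbedding.subtype_coe hT).aemeasurable_map_iff, map_comap_subtype_coe hT, restrict_withDensity hT]
  exact hg.mono_ac (withDensity_absolutelyContinuous _ _)

include hlie in
/-- A map `Ψ` of `G^B` reading a map `ψ` continuous on a Borel `S ⊆ Ω^B` in the product chart (`Ψ(Θ^B X) = Θ^B(ψ X)` on `S`) is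
`(⊗μ)|_{Θ^B S}`-a.e.-measurable. [cite: Balaban1985UV3, (18) p. 260] [cite: Helgason2000, Ch. I §1 Thm. 1.14 (13) p. 96] -/
theorem aemeasurable_pi_restrict_image_of_semiconj {s : ℝ} (hs0 : 0 < s) (hs : s ≤ chartRadius C)
    {Ω : Set C.lie} (hΩ : MeasurableSet Ω) (hinj : Set.InjOn h.expChart Ω) {S : Set (B → C.lie)} (hS : MeasurableSet S)
    (hSΩ : S ⊆ Set.pi Set.univ fun _ => Ω) {ψ : (B → C.lie) → (B → C.lie)} (hψc : ContinuousOn ψ S)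
    {Ψ : (B → G) → (B → G)} (hΨ : ∀ X ∈ S, Ψ (fun b => h.expChart (X b)) = fun b => h.expChart (ψ X b)) :
    AEMeasurable Ψ ((Measure.pi fun _ : B => μ).restrict ((fun (A : B → C.lie) (b : B) => h.expChart (A b)) '' S)) := by
  let η : Measure C.lie := (Module.finBasis ℝ C.lie).addHaar
  refine h.aemeasurable_pi_restrict_image_of_comp_piChart hlie η μ B hs0 hs hΩ hinj hS hSΩ ?_
  have hΘB : Measurable (fun (A : B → C.lie) (b : B) => h.expChart (A b)) :=
    measurable_pi_lambda _ fun b => h.measurable_expChart.comp (measurable_pi_apply b)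
  have h1 : AEMeasurable ((fun (A : B → C.lie) (b : B) => h.expChart (A b)) ∘ ψ) ((Measure.pi fun _ : B => η).restrict S) :=
    hΘB.comp_aemeasurable (hψc.aemeasurable hS)
  exact h1.congr ((ae_restrict_mem hS).mono fun X hX => (hΨ X hX).symm)

/-- The product Jacobian `J_Ψ(U) = (Π_b |det jac((ψ(Λ^B U))_b)|) · |det ψ′(Λ^B U)| / Π_b |det jac(Λ U_b)|` is `(⊗μ)|_{Θ^B S}`-a.e.-measurable
(`S ⊆ B(0,s)^B` Borel; `ψ′` a.e.-measurable on `S` by Mathlib's `aemeasurable_fderivWithin` on the finite-dimensional space `B → 𝔤`).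
[cite: Balaban1985UV3, (18) p. 260] [cite: Helgason2000, Ch. I §1 Thm. 1.14 (12)–(13) p. 96] -/
theorem aemeasurable_pi_jacobian {s : ℝ} (hs0 : 0 < s) (hs : s ≤ chartRadius C)
    {S : Set (B → C.lie)} (hS : MeasurableSet S) (hSs : S ⊆ Set.pi Set.univ fun _ => Metric.ball (0 : C.lie) s)
    {ψ : (B → C.lie) → (B → C.lie)} {ψ' : (B → C.lie) → (B → C.lie) →L[ℝ] (B → C.lie)}
    (hψ' : ∀ X ∈ S, HasFDerivWithinAt ψ (ψ' X) S X) :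
    AEMeasurable (fun U : B → G => (∏ b, jacDensity hlie (ψ (fun b => h.logChart (U b)) b)) *
        ENNReal.ofReal |(ψ' fun b => h.logChart (U b)).det| / ∏ b, jacDensity hlie (h.logChart (U b)))
      ((Measure.pi fun _ : B => μ).restrict ((fun (A : B → C.lie) (b : B) => h.expChart (A b)) '' S)) := by
  let η : Measure C.lie := (Module.finBasis ℝ C.lie).addHaar
  have hΩ : MeasurableSet (Metric.ball (0 : C.lie) s) := Metric.isOpen_ball.measurableSet
  refine h.aemeasurable_pi_restrict_image_of_comp_piChart hlie η μ B hs0 hs hΩ (h.injOn_expChart hs) hS hSs ?_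
  have hψc : ContinuousOn ψ S := fun X hX => (hψ' X hX).continuousWithinAt
  have hprod : Measurable fun A : B → C.lie => ∏ b, jacDensity hlie (A b) :=
    Finset.measurable_prod _ fun b _ => (measurable_jacDensity hlie).comp (measurable_pi_apply b)
  have ha : AEMeasurable (fun X => ∏ b, jacDensity hlie (ψ X b)) ((Measure.pi fun _ : B => η).restrict S) :=
    hprod.comp_aemeasurable (hψc.aemeasurable hS)
  have hb : AEMeasurable (fun X => ENNReal.ofReal |(ψ' X).det|) ((Measure.pi fun _ : B => η).restrict S) :=
    ENNReal.measurable_ofReal.comp_aemeasurable ((continuous_abs.measurable.comp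
      ContinuousLinearMap.continuous_det.measurable).comp_aemeasurable
        (aemeasurable_fderivWithin (Measure.pi fun _ : B => η) hS hψ'))
  have hj : AEMeasurable (fun X => (∏ b, jacDensity hlie (ψ X b)) * ENNReal.ofReal |(ψ' X).det| /
      ∏ b, jacDensity hlie (X b)) ((Measure.pi fun _ : B => η).restrict S) := (ha.mul hb).div hprod.aemeasurable
  refine hj.congr ((ae_restrict_mem hS).mono fun X hX => ?_)
  have hΛ : (fun b => h.logChart (h.expChart (X b))) = X := funext fun b =>
    h.logChart_expChart (lt_of_lt_of_le (mem_ball_zero_iff.1 (hSs hX b (Set.mem_univ b))) hs)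
  simp only [Function.comp_apply, hΛ]
  exact congrArg _ (Finset.prod_congr rfl fun b _ => by
    rw [h.logChart_expChart (lt_of_lt_of_le (mem_ball_zero_iff.1 (hSs hX b (Set.mem_univ b))) hs)]).symm

omit [IsTopologicalGroup G] [μ.IsHaarMeasure] in
/-- The product Jacobian is finite `(⊗μ)|_{Θ^B S}`-a.e. when `det jac(X_b) ≠ 0` on `S ⊆ B(0,s)^B`.
[cite: Helgason2000, Ch. I §1 Thm. 1.14 (12) p. 96] -/
theorem pi_jacobian_lt_top_ae {s : ℝ} (hs : s ≤ chartRadius C)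
    {S : Set (B → C.lie)} (hS : MeasurableSet S) (hSs : S ⊆ Set.pi Set.univ fun _ => Metric.ball (0 : C.lie) s)
    (hjac : ∀ X ∈ S, ∀ b, LinearMap.det (jac hlie (X b) : C.lie →ₗ[ℝ] C.lie) ≠ 0)
    (ψ : (B → C.lie) → (B → C.lie)) (ψ' : (B → C.lie) → (B → C.lie) →L[ℝ] (B → C.lie)) :
    ∀ᵐ U ∂(Measure.pi fun _ : B => μ).restrict ((fun (A : B → C.lie) (b : B) => h.expChart (A b)) '' S),
      (∏ b, jacDensity hlie (ψ (fun b => h.logChart (U b)) b)) * ENNReal.ofReal |(ψ' fun b => h.logChart (U b)).det| /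
        ∏ b, jacDensity hlie (h.logChart (U b)) < ∞ := by
  haveI : T2Space G := h.isClosedEmbedding.isEmbedding.t2Space
  haveI : SecondCountableTopology G := h.secondCountableTopology
  have hSimg : MeasurableSet ((fun (A : B → C.lie) (b : B) => h.expChart (A b)) '' S) :=
    hS.image_of_continuousOn_injOn (continuous_pi fun b => h.continuous_expChart.comp (continuous_apply b)).continuousOn
      ((h.injOn_piChart_pi B (h.injOn_expChart hs)).mono hSs)
  refine (ae_restrict_mem hSimg).mono ?_
  rintro _ ⟨X, hX, rfl⟩
  have hΛ : ∀ b, h.logChart (h.expChart (X b)) = X b := fun b =>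
    h.logChart_expChart (lt_of_lt_of_le (mem_ball_zero_iff.1 (hSs hX b (Set.mem_univ b))) hs)
  have hj0 : ∏ b, jacDensity hlie (h.logChart (h.expChart (X b))) ≠ 0 := Finset.prod_ne_zero_iff.2 fun b _ => by
    rw [hΛ b, jacDensity_def]
    exact fun h0 => hjac X hX b (abs_eq_zero.1 (ENNReal.ofReal_eq_zero.1 h0 |>.antisymm (abs_nonneg _)))
  refine ENNReal.div_lt_top (ENNReal.mul_ne_top (ENNReal.prod_ne_top fun b _ => ?_) ENNReal.ofReal_ne_top) hj0
  rw [jacDensity_def]; exact ENNReal.ofReal_ne_top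

/-! ## §2 The measure form and the Bochner form on `G^B` -/

/-- **THE MEASURE FORM OF THE GROUP-LEVEL JACOBIAN ON `G^B`**: under the hypotheses of file 2's
`lintegral_pi_haar_image_eq_lintegral_mul_jacobian` (`S ⊆ B(0,s)^B` Borel with `det jac(X_b) ≠ 0`, `ψ` injective and
differentiable within `S`, `ψ(S) ⊆ B(0,s)^B`, `Ψ ∘ Θ^B = Θ^B ∘ ψ` on `S`):  **`(⊗μ)|_{Ψ(Θ^B S)} = Ψ_*(J_Ψ · (⊗μ)|_{Θ^B S})`** — the
product Haar measure of the bond variables restricted to the image is the push-forward under `Ψ` of itself on `Θ^B S`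
weighted by the Jacobian (the «fibred chart» shape on `G^B`, no window constant, no Lebesgue measure).
[cite: Balaban1985UV3, (18) p. 260] [cite: Balaban1987RG1, (2.10) p. 267] [cite: Helgason2000, Ch. I §1 Thm. 1.14 (13) p. 96] -/
theorem pi_haar_restrict_image_eq_map_withDensity_jacobian {s : ℝ} (hs0 : 0 < s) (hs : s ≤ chartRadius C)
    {S : Set (B → C.lie)} (hS : MeasurableSet S) (hSs : S ⊆ Set.pi Set.univ fun _ => Metric.ball (0 : C.lie) s)
    (hjac : ∀ X ∈ S, ∀ b, LinearMap.det (jac hlie (X b) : C.lie →ₗ[ℝ] C.lie) ≠ 0)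
    {ψ : (B → C.lie) → (B → C.lie)} {ψ' : (B → C.lie) → (B → C.lie) →L[ℝ] (B → C.lie)}
    (hψ' : ∀ X ∈ S, HasFDerivWithinAt ψ (ψ' X) S X) (hψ : Set.InjOn ψ S)
    (hψS : Set.MapsTo ψ S (Set.pi Set.univ fun _ => Metric.ball (0 : C.lie) s)) {Ψ : (B → G) → (B → G)}
    (hΨ : ∀ X ∈ S, Ψ (fun b => h.expChart (X b)) = fun b => h.expChart (ψ X b)) :
    (Measure.pi fun _ : B => μ).restrict (Ψ '' ((fun (A : B → C.lie) (b : B) => h.expChart (A b)) '' S)) =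
      Measure.map Ψ (((Measure.pi fun _ : B => μ).restrict ((fun (A : B → C.lie) (b : B) => h.expChart (A b)) '' S)).withDensity
        fun U => (∏ b, jacDensity hlie (ψ (fun b => h.logChart (U b)) b)) *
          ENNReal.ofReal |(ψ' fun b => h.logChart (U b)).det| / ∏ b, jacDensity hlie (h.logChart (U b))) := by
  have hΩ : MeasurableSet (Metric.ball (0 : C.lie) s) := Metric.isOpen_ball.measurableSet
  have hψc : ContinuousOn ψ S := fun X hX => (hψ' X hX).continuousWithinAt
  have hΨm := h.aemeasurable_pi_restrict_image_of_semiconj hlie μ B hs0 hs hΩ (h.injOn_expChart hs) hS hSs hψc hΨ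
  have hJm := h.aemeasurable_pi_jacobian hlie μ B hs0 hs hS hSs hψ'
  have hJtop := h.pi_jacobian_lt_top_ae hlie μ B hs hS hSs hjac ψ ψ'
  have hΨm' := hΨm.mono_ac (withDensity_absolutelyContinuous
    ((Measure.pi fun _ : B => μ).restrict ((fun (A : B → C.lie) (b : B) => h.expChart (A b)) '' S))
    (fun U => (∏ b, jacDensity hlie (ψ (fun b => h.logChart (U b)) b)) *
      ENNReal.ofReal |(ψ' fun b => h.logChart (U b)).det| / ∏ b, jacDensity hlie (h.logChart (U b))))
  refine Measure.ext_of_lintegral _ fun f hf => ?_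
  rw [lintegral_map' hf.aemeasurable hΨm', lintegral_withDensity_eq_lintegral_mul_non_measurable₀ _ hJm hJtop]
  show ∫⁻ U in Ψ '' ((fun (A : B → C.lie) (b : B) => h.expChart (A b)) '' S), f U ∂(Measure.pi fun _ : B => μ) = _
  rw [h.lintegral_pi_haar_image_eq_lintegral_mul_jacobian hlie μ B hs0 hs hS hSs hjac hψ' hψ hψS hΨ f]
  exact lintegral_congr fun U => mul_comm _ _

variable {E : Type*} [NormedAddCommGroup E] [NormedSpace ℝ E]

/-- **THE BOCHNER FORM OF THE GROUP-LEVEL JACOBIAN ON `G^B`**: under the same hypotheses, for every `F : (B → G) → E`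
a.e.-strongly measurable on `Ψ(Θ^B S)`:  `∫_{Ψ(Θ^B S)} F d⊗μ = ∫_{Θ^B S} (J_Ψ U).toReal • F(Ψ U) d⊗μ(U)`.
[cite: Balaban1985UV3, (18) p. 260] [cite: Balaban1987RG1, (2.10) p. 267] [cite: Helgason2000, Ch. I §1 Thm. 1.14 (13) p. 96] -/
theorem setIntegral_pi_haar_image_eq_integral_jacobian_smul {s : ℝ} (hs0 : 0 < s) (hs : s ≤ chartRadius C)
    {S : Set (B → C.lie)} (hS : MeasurableSet S) (hSs : S ⊆ Set.pi Set.univ fun _ => Metric.ball (0 : C.lie) s)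
    (hjac : ∀ X ∈ S, ∀ b, LinearMap.det (jac hlie (X b) : C.lie →ₗ[ℝ] C.lie) ≠ 0)
    {ψ : (B → C.lie) → (B → C.lie)} {ψ' : (B → C.lie) → (B → C.lie) →L[ℝ] (B → C.lie)}
    (hψ' : ∀ X ∈ S, HasFDerivWithinAt ψ (ψ' X) S X) (hψ : Set.InjOn ψ S)
    (hψS : Set.MapsTo ψ S (Set.pi Set.univ fun _ => Metric.ball (0 : C.lie) s)) {Ψ : (B → G) → (B → G)}
    (hΨ : ∀ X ∈ S, Ψ (fun b => h.expChart (X b)) = fun b => h.expChart (ψ X b)) {F : (B → G) → E}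
    (hF : AEStronglyMeasurable F
      ((Measure.pi fun _ : B => μ).restrict (Ψ '' ((fun (A : B → C.lie) (b : B) => h.expChart (A b)) '' S)))) :
    ∫ U in Ψ '' ((fun (A : B → C.lie) (b : B) => h.expChart (A b)) '' S), F U ∂(Measure.pi fun _ : B => μ) =
      ∫ U in (fun (A : B → C.lie) (b : B) => h.expChart (A b)) '' S,
        ((∏ b, jacDensity hlie (ψ (fun b => h.logChart (U b)) b)) * ENNReal.ofReal |(ψ' fun b => h.logChart (U b)).det| /
          ∏ b, jacDensity hlie (h.logChart (U b))).toReal • F (Ψ U) ∂(Measure.pi fun _ : B => μ) := by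
  have hΩ : MeasurableSet (Metric.ball (0 : C.lie) s) := Metric.isOpen_ball.measurableSet
  have hψc : ContinuousOn ψ S := fun X hX => (hψ' X hX).continuousWithinAt
  have hΨm := h.aemeasurable_pi_restrict_image_of_semiconj hlie μ B hs0 hs hΩ (h.injOn_expChart hs) hS hSs hψc hΨ
  have hJm := h.aemeasurable_pi_jacobian hlie μ B hs0 hs hS hSs hψ'
  have hJtop := h.pi_jacobian_lt_top_ae hlie μ B hs hS hSs hjac ψ ψ'
  have hμ := h.pi_haar_restrict_image_eq_map_withDensity_jacobian hlie μ B hs0 hs hS hSs hjac hψ' hψ hψS hΨ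
  have hΨm' := hΨm.mono_ac (withDensity_absolutelyContinuous
    ((Measure.pi fun _ : B => μ).restrict ((fun (A : B → C.lie) (b : B) => h.expChart (A b)) '' S))
    (fun U => (∏ b, jacDensity hlie (ψ (fun b => h.logChart (U b)) b)) *
      ENNReal.ofReal |(ψ' fun b => h.logChart (U b)).det| / ∏ b, jacDensity hlie (h.logChart (U b))))
  rw [hμ] at hF ⊢
  rw [integral_map hΨm' hF, integral_withDensity_eq_integral_toReal_smul₀ hJm hJtop]

/-! ## §3 The chart on one factor of a product (the coarse side `(⊗μ)|_{Θ^B T} ⊗ τ` of a fibred chart) -/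

/-- **THE CHART ON ONE FACTOR OF A PRODUCT MEASURE**: for every s-finite measure `τ` on a measurable space `Z`, every Borel
injectivity domain `Ω` of `Θ` (`0 < s ≤ s_C`) and every Borel `T ⊆ Ω^B`:
`((⊗μ)|_{Θ^B T}) ⊗ τ = σ₀^{|B|} • (Θ^B × id)_*((((Π_b |det jac A_b|) · (⊗η)|_T)) ⊗ τ)` — file 2's `pi_haar_restrict_image_eq_smul`
tensored with `τ` (Mathlib `Measure.map_prod_map`, `prod_smul_left`): the shape `((⊗μ)|_D ⊗ τ)` in which the coarse-variable side of a
«fibred chart» `ν|_{avg⁻¹ D ∩ S} = Φ_*(J · ((⊗μ)|_D ⊗ τ))` is read in bond-wise exponential coordinates.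
[cite: Balaban1985UV3, (18) p. 260] [cite: Balaban1987RG1, (2.10) p. 267] [cite: Helgason2000, Ch. I §1 Thm. 1.14 (13) p. 96] -/
theorem pi_haar_restrict_image_prod_eq_smul_map {s : ℝ} (hs0 : 0 < s) (hs : s ≤ chartRadius C) {Ω : Set C.lie}
    (hΩ : MeasurableSet Ω) (hinj : Set.InjOn h.expChart Ω) {T : Set (B → C.lie)} (hT : MeasurableSet T)
    (hTΩ : T ⊆ Set.pi Set.univ fun _ => Ω) {Z : Type*} [MeasurableSpace Z] (τ : Measure Z) [SFinite τ] :
    ((Measure.pi fun _ : B => μ).restrict ((fun (A : B → C.lie) (b : B) => h.expChart (A b)) '' T)).prod τ =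
      (μ (h.window s) / h.chartMeasure hlie η s (h.window s)) ^ Fintype.card B •
        ((((Measure.pi fun _ : B => η).restrict T).withDensity (fun A => ∏ b, jacDensity hlie (A b))).prod τ).map
          (Prod.map (fun (A : B → C.lie) (b : B) => h.expChart (A b)) id) := by
  have hΘB : Measurable (fun (A : B → C.lie) (b : B) => h.expChart (A b)) :=
    measurable_pi_lambda _ fun b => h.measurable_expChart.comp (measurable_pi_apply b)
  rw [h.pi_haar_restrict_image_eq_smul hlie η μ B hs0 hs hΩ hinj hT hTΩ, Measure.prod_smul_left,
    ← Measure.map_prod_map _ _ hΘB measurable_id, Measure.map_id]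

/-! ## §4 Translated windows `Θ^B(T) · U₀`: the chart centred at an arbitrary configuration `U₀ ∈ G^B` -/

/-- **THE WINDOW IDENTITY AT A TRANSLATED WINDOW (measure form)**: for a right-invariant Haar measure `μ`, every `U₀ ∈ G^B`, every
Borel injectivity domain `Ω` of `Θ` (`0 < s ≤ s_C`) and every Borel `T ⊆ Ω^B`:
`(⊗μ)|_{Θ^B(T)·U₀} = σ₀^{|B|} • (A ↦ Θ^B(A)·U₀)_*((Π_b |det jac A_b|) · (⊗η)|_T)` — file 2's `pi_haar_restrict_image_eq_smul` transported by
the bond-wise right translation `U ↦ U·U₀`, which preserves `⊗μ`. [cite: Balaban1985UV3, (18) p. 260] [cite: Helgason2000, Ch. I §1 Thm. 1.14 (13) p. 96] -/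
theorem pi_haar_restrict_translate_image_eq_smul [μ.IsMulRightInvariant] {s : ℝ} (hs0 : 0 < s) (hs : s ≤ chartRadius C)
    {Ω : Set C.lie} (hΩ : MeasurableSet Ω) (hinj : Set.InjOn h.expChart Ω) {T : Set (B → C.lie)} (hT : MeasurableSet T)
    (hTΩ : T ⊆ Set.pi Set.univ fun _ => Ω) (U₀ : B → G) :
    (Measure.pi fun _ : B => μ).restrict
        ((fun (U : B → G) (b : B) => U b * U₀ b) '' ((fun (A : B → C.lie) (b : B) => h.expChart (A b)) '' T)) =
      (μ (h.window s) / h.chartMeasure hlie η s (h.window s)) ^ Fintype.card B •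
        (((Measure.pi fun _ : B => η).restrict T).withDensity (fun A => ∏ b, jacDensity hlie (A b))).map
          (fun (A : B → C.lie) (b : B) => h.expChart (A b) * U₀ b) := by
  haveI : T2Space G := h.isClosedEmbedding.isEmbedding.t2Space
  have hΘB : Measurable (fun (A : B → C.lie) (b : B) => h.expChart (A b)) :=
    measurable_pi_lambda _ fun b => h.measurable_expChart.comp (measurable_pi_apply b)
  let e : (B → G) ≃ᵐ (B → G) := MeasurableEquiv.mulRight U₀
  have he : (fun (U : B → G) (b : B) => U b * U₀ b) = e := rfl
  have hinv : (Measure.pi fun _ : B => μ).map e = Measure.pi fun _ : B => μ :=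
    MeasureTheory.map_mul_right_eq_self (Measure.pi fun _ : B => μ) U₀
  have hcomp : (fun (A : B → C.lie) (b : B) => h.expChart (A b) * U₀ b) = e ∘ fun (A : B → C.lie) (b : B) => h.expChart (A b) := rfl
  rw [he, hcomp]
  conv_lhs => rw [← hinv]
  rw [e.measurableEmbedding.restrict_map, e.injective.preimage_image,
    h.pi_haar_restrict_image_eq_smul hlie η μ B hs0 hs hΩ hinj hT hTΩ, Measure.map_smul, Measure.map_map e.measurable hΘB]

/-- **(18) ON A TRANSLATED WINDOW FOR EVERY INTEGRAND**: with `μ` right invariant and `U₀ ∈ G^B`,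
`∫_{Θ^B(T)·U₀} F d(⊗μ) = σ₀^{|B|} · ∫_T F(Θ^B(A)·U₀) · Π_b |det jac(A_b)| d(⊗η)` for every `F : (B → G) → ℝ≥0∞`.
[cite: Balaban1985UV3, (18) p. 260] [cite: Helgason2000, Ch. I §1 Thm. 1.14 (13) p. 96] -/
theorem lintegral_pi_haar_translate_image_eq [μ.IsMulRightInvariant] {s : ℝ} (hs0 : 0 < s) (hs : s ≤ chartRadius C)
    {Ω : Set C.lie} (hΩ : MeasurableSet Ω) (hinj : Set.InjOn h.expChart Ω) {T : Set (B → C.lie)} (hT : MeasurableSet T)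
    (hTΩ : T ⊆ Set.pi Set.univ fun _ => Ω) (U₀ : B → G) (F : (B → G) → ℝ≥0∞) :
    ∫⁻ U in (fun (U : B → G) (b : B) => U b * U₀ b) '' ((fun (A : B → C.lie) (b : B) => h.expChart (A b)) '' T), F U
        ∂(Measure.pi fun _ : B => μ) =
      (μ (h.window s) / h.chartMeasure hlie η s (h.window s)) ^ Fintype.card B *
        ∫⁻ A in T, F (fun b => h.expChart (A b) * U₀ b) * ∏ b, jacDensity hlie (A b) ∂(Measure.pi fun _ : B => η) := by
  have hmp : MeasurePreserving (fun (U : B → G) (b : B) => U b * U₀ b) (Measure.pi fun _ : B => μ) (Measure.pi fun _ : B => μ) :=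
    measurePreserving_mul_right (Measure.pi fun _ : B => μ) U₀
  have hemb : MeasurableEmbedding (fun (U : B → G) (b : B) => U b * U₀ b) := (MeasurableEquiv.mulRight U₀).measurableEmbedding
  rw [← hmp.setLIntegral_comp_emb hemb F]
  exact h.lintegral_pi_haar_image_eq hlie η μ B hs0 hs hΩ hinj hT hTΩ (fun U => F fun b => U b * U₀ b)

/-- **THE COARSE SIDE OF A FIBRED CHART AT A TRANSLATED WINDOW**: with `μ` right invariant, `V₀ ∈ G^B` and `τ` s-finite,
`((⊗μ)|_{Θ^B(T)·V₀}) ⊗ τ = σ₀^{|B|} • ((A ↦ Θ^B(A)·V₀) × id)_*(((Π_b |det jac A_b|) · (⊗η)|_T) ⊗ τ)`.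
[cite: Balaban1985UV3, (18) p. 260] [cite: Balaban1987RG1, (2.10) p. 267] [cite: Helgason2000, Ch. I §1 Thm. 1.14 (13) p. 96] -/
theorem pi_haar_restrict_translate_image_prod_eq_smul_map [μ.IsMulRightInvariant] {s : ℝ} (hs0 : 0 < s) (hs : s ≤ chartRadius C)
    {Ω : Set C.lie} (hΩ : MeasurableSet Ω) (hinj : Set.InjOn h.expChart Ω) {T : Set (B → C.lie)} (hT : MeasurableSet T)
    (hTΩ : T ⊆ Set.pi Set.univ fun _ => Ω) (V₀ : B → G) {Z : Type*} [MeasurableSpace Z] (τ : Measure Z) [SFinite τ] :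
    ((Measure.pi fun _ : B => μ).restrict
        ((fun (U : B → G) (b : B) => U b * V₀ b) '' ((fun (A : B → C.lie) (b : B) => h.expChart (A b)) '' T))).prod τ =
      (μ (h.window s) / h.chartMeasure hlie η s (h.window s)) ^ Fintype.card B •
        ((((Measure.pi fun _ : B => η).restrict T).withDensity (fun A => ∏ b, jacDensity hlie (A b))).prod τ).map
          (Prod.map (fun (A : B → C.lie) (b : B) => h.expChart (A b) * V₀ b) id) := by
  haveI : T2Space G := h.isClosedEmbedding.isEmbedding.t2Space
  have hΘB : Measurable (fun (A : B → C.lie) (b : B) => h.expChart (A b) * V₀ b) :=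
    measurable_pi_lambda _ fun b => (h.measurable_expChart.comp (measurable_pi_apply b)).mul_const _
  rw [h.pi_haar_restrict_translate_image_eq_smul hlie η μ B hs0 hs hΩ hinj hT hTΩ V₀, Measure.prod_smul_left,
    ← Measure.map_prod_map _ _ hΘB measurable_id, Measure.map_id]

end IsChartRep

end Literature.MathematicalPhysics.QuantumFieldTheory.Balaban1983to89.HaarExponentialChart
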